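import Summits.HubbardSuperconductivity.HubbardSuperconductivity.Theorems.AnisotropyChordTransferFibre3RowCExpr
import Summits.HubbardSuperconductivity.HubbardSuperconductivity.Theorems.AnisotropyChordTransferFibre3RowCXSCells
import Summits.HubbardSuperconductivity.HubbardSuperconductivity.Theorems.AnisotropyChordTransferFibre3N1RowCellSound
import Summits.HubbardSuperconductivity.HubbardSuperconductivity.Theorems.AnisotropyChordTransferFibre3Cs2Fold

/-!
# Route `AnisotropyChord` / H0 rotor rung, row C (KT-2b) of the LEVEL-2 certificate: ★★★ a PASSING ROW-C CELL CHECK bounds the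
off-pole tail for ALL `L ≥ 128` on the cell

Composition of the row-C pipeline (p1 g28) on p2's Level-2 cell machinery (`…N1RowCellSound`): if
`rowCCellCheck c a₁ a₂ xshi bC (prec, iters) = true` (`…RowCExpr`), the column's named-sum certificate `c.check = true`, the
X-sum certificate `xsCellCheck 128 … c.bS2.2 c.bT10.2 xshi = true` (`…RowCXSCells`) hold, and the window-shell bound
`Σ_{b ∈ shellWin} C0(x̂,b)² ≤ ZwN` (hypothesis `hZ`, the crude window-shell majorant, proved separately in `…RowCShellWin`) is available, then for EVERY `L ≥ 128` and EVERY ground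
two-magnon profile (`0 ≤ Δ < 1`) whose cell variables lie in the cell:
  `‖R′‖² − polePart − lowNormPart ≤ bC·η_eff·(2ε₁ − T⁺)·U`
— the (KT-2b″) inequality `OffPoleTailAbs` at that `(L, Δ)` with constant `bC`.
Chain: `pmem_xTrue` + `xTrue_specs_ground` + the five object theorems ⇒ the final vector lies in p2's final box; extension by
`x₄ ∈ c.bS2`, `a_λ(1,1) ∈ k11I`, `a_λ(2,0) ∈ k20I` (`ManifoldA.second_shell_window`); `rexprLeOn_sound`; `eval_rowCE`;
`cs2_le_ChiN` (with `xs_cell_sound`), `nC0p_le_NhiN` (with `hZ`), `T⁺ = θ²(3ν − (3/2)Q̂₁/P̂)` (p1's one-loop identities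
as in `trialGap_of_cellCheck`), `offPoleTailFromPieces_holds`, `polePart, lowNormPart ≥ 0`.
Prover seat `hubbard-h0-rotor-p1` g28 (route lead); helper for piece A = stmt-HubbardSuperconductivity-23918 of rung 19089
(`--supports`, helper class).  WHAT THIS IS NOT: nothing here proves superconductivity in the Hubbard model, nor the crux: it
reduces the KT-2b row for all `L ≥ 128` to kernel cell checks plus one window lemma; the rotor TARGET as originally worded
stays FALSE (g15 verdict).  Tree imports only; no sorry, no new axioms.
-/

set_option linter.dupNamespace false
set_option autoImplicit false

open Literature.Analysis.ValidatedNumerics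

namespace Summit.HubbardSuperconductivity.HubbardSuperconductivity.Theorems.AnisotropyChord.Transfer.Fibre3

namespace RowC

open L2.N1

variable (L : ℕ) [NeZero L]

/-- the extended vector `(y₀,…,y₉, x₄, k₁₁, k₂₀, 0, …)`. -/
noncomputable def extVec (y : ℕ → ℝ) (x4 k11 k20 : ℝ) : ℕ → ℝ := fun i =>
  if i < 10 then y i else if i = 10 then x4 else if i = 11 then k11 else if i = 12 then k20 else 0

/-- membership of the extended vector in the extended box. [folklore] -/
theorem extVec_mem (c : L2.NamedCell) {F : Box} (hF : F.length = 10) {y : ℕ → ℝ} (hy : F.mem y) {x4 k11 k20 : ℝ}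
    (h4 : ((c.bS2.1 : ℚ) : ℝ) ≤ x4 ∧ x4 ≤ ((c.bS2.2 : ℚ) : ℝ))
    (h11 : ((k11I.1 : ℚ) : ℝ) ≤ k11 ∧ k11 ≤ ((k11I.2 : ℚ) : ℝ))
    (h20 : ((k20I.1 : ℚ) : ℝ) ≤ k20 ∧ k20 ≤ ((k20I.2 : ℚ) : ℝ)) :
    (rowCBox c F).mem (extVec y x4 k11 k20) := by
  intro i
  unfold rowCBox extVec Box.ivl
  by_cases hi : i < 10
  · rw [if_pos hi, List.getD_eq_getElem?_getD, List.getElem?_append_left (by omega), ← List.getD_eq_getElem?_getD]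
    exact hy i
  rw [if_neg hi, List.getD_eq_getElem?_getD, List.getElem?_append_right (by omega), hF]
  by_cases h10 : i = 10
  · subst h10; simpa using h4
  by_cases h11' : i = 11
  · subst h11'; simpa using h11
  by_cases h12 : i = 12
  · subst h12; simpa using h20
  rw [if_neg h10, if_neg h11', if_neg h12]
  have : [c.bS2, k11I, k20I][i - 10]?.getD (0, 0) = (0, 0) := by
    rw [List.getElem?_eq_none (by simp; omega)]; rfl
  rw [this]; simp

/-- `1/π ∈ (0.318309, 0.3183099)`. [folklore] -/
theorem inv_pi_bounds : 0.318309 < 1 / Real.pi ∧ 1 / Real.pi < 0.3183099 := by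
  have hπ := Real.pi_pos
  have hπlo := Real.pi_gt_d20
  have hπhi := Real.pi_lt_d6
  constructor
  · rw [lt_div_iff₀ hπ]; nlinarith
  · rw [div_lt_iff₀ hπ]; nlinarith

/-- the two second-shell window values of the ground profile lie in the rational intervals `k11I`, `k20I` (`L ≥ 128`). [folklore] -/
theorem window_k11_k20 (hL : 128 ≤ L) {Δ lam2 : ℝ} {f : Tor L → ℝ} (hΔ0 : 0 ≤ Δ) (hΔ1 : Δ < 1)
    (hf : IsGroundTwoMagnon L Δ lam2 f) :
    (((k11I.1 : ℚ) : ℝ) ≤ aKer L lam2 (ex L + ey L) ∧ aKer L lam2 (ex L + ey L) ≤ ((k11I.2 : ℚ) : ℝ)) ∧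
    (((k20I.1 : ℚ) : ℝ) ≤ aKer L lam2 (ex L + ex L) ∧ aKer L lam2 (ex L + ex L) ≤ ((k20I.2 : ℚ) : ℝ)) := by
  have hLpos : (0 : ℝ) < L := by exact_mod_cast (show 0 < L by omega)
  have hπ := Real.pi_pos
  set θ : ℝ := 2 * Real.pi / L with hθ
  have ht0 : 0 < θ ^ 2 := by positivity
  have hlam : 0 < lam2 := lam2_pos L (by omega) hΔ1 hf.1
  have hνc := ManifoldA.nu_ceiling L hL hΔ0 hf
  have hν0 : 0 ≤ lam2 / θ ^ 2 := by positivity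
  have hν5 : lam2 / θ ^ 2 ≤ 0.0513 := by
    rw [div_le_iff₀ ht0, hθ]
    have hx0 : 0 ≤ (2 * Real.pi / (L : ℝ)) ^ 2 := sq_nonneg _
    linarith [hνc]
  have hlamθ : lam2 = lam2 / θ ^ 2 * (2 * Real.pi / L) ^ 2 := by rw [hθ]; field_simp
  obtain ⟨hw11, hw20⟩ := ManifoldA.second_shell_window L hL (lam2 / θ ^ 2) hν0 hν5
  rw [← hlamθ] at hw11 hw20
  have e11 : ((((1 : ℤ)) : ZMod L), (((1 : ℤ)) : ZMod L)) = ex L + ey L := by unfold ex ey; ext <;> simp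
  have e20 : ((((2 : ℤ)) : ZMod L), (((0 : ℤ)) : ZMod L)) = ex L + ex L := by
    unfold ex; ext <;> simp
    norm_num
  rw [e11] at hw11
  rw [e20] at hw20
  obtain ⟨hp1, hp2⟩ := inv_pi_bounds
  obtain ⟨hl1, hh1⟩ := abs_le.mp hw11
  obtain ⟨hl2, hh2⟩ := abs_le.mp hw20
  have e2 : 2 / Real.pi = 2 * (1 / Real.pi) := by ring
  rw [e2] at hl2 hh2
  unfold k11I k20I
  push_cast
  exact ⟨⟨by linarith, by linarith⟩, ⟨by linarith, by linarith⟩⟩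

/-- ★ CORE: a passing row-C check gives, at the ground profile, `P̂ > 0` and the evaluated row inequality
`9(√ChiN + √NhiN)² ≤ 48π⁴·bC·π²ν·(2ê₁ − τ)·τ`, `τ = 3ν − (3/2)Q̂₁/P̂`. [folklore] -/
theorem rowC_core (c : L2.NamedCell) (a1 a2 xshi bC : ℚ) (pi : ℕ × ℕ)
    (hchk : rowCCellCheck c a1 a2 xshi bC pi = true) (hc : c.check = true) (hL : 128 ≤ L)
    {Δ lam2 : ℝ} {f : Tor L → ℝ} (hΔ0 : 0 ≤ Δ) (hΔ1 : Δ < 1) (hf : IsGroundTwoMagnon L Δ lam2 f)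
    (hν1 : (c.n1 : ℝ) / c.νd ≤ lam2 / (2 * Real.pi / L) ^ 2) (hν2 : lam2 / (2 * Real.pi / L) ^ 2 ≤ (c.n2 : ℝ) / c.νd)
    (ha1 : ((a1 : ℚ) : ℝ) ≤ Δ * f (K1 L)) (ha2 : Δ * f (K1 L) ≤ ((a2 : ℚ) : ℝ)) :
    let t : ℝ := (2 * Real.pi / L) ^ 2
    let vP : ℝ := t ^ 3 * ∑ k : Tor L, F2 L f k ^ 3
    let vQ : ℝ := t ^ 2 * ∑ k : Tor L, nK L f k * F2 L f k
    0 < vP ∧ t ^ 2 * S2n L lam2 ≤ ((c.bS2.2 : ℚ) : ℝ) ∧ t ^ 2 * T10n L lam2 ≤ ((c.bT10.2 : ℚ) : ℝ) ∧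
    9 * (Real.sqrt (ChiN t (lam2 / t) (Δ * f (K1 L)) (eps1 L / t) (t ^ 2 * S2n L lam2) xshi)
        + Real.sqrt (NhiN t (lam2 / t) (Δ * f (K1 L)) (t ^ 2 * S2n L lam2) (aKer L lam2 (ex L + ey L))
            (aKer L lam2 (ex L + ex L)) (ZwN t (lam2 / t) (Δ * f (K1 L))))) ^ 2
      - 48 * (Real.pi ^ 2) ^ 2 * bC * (Real.pi ^ 2 * (lam2 / t)) * (2 * (eps1 L / t) - (3 * (lam2 / t) - 3 / 2 * vQ * vP⁻¹))
          * (3 * (lam2 / t) - 3 / 2 * vQ * vP⁻¹) ≤ 0 := by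
  classical
  intro t vP vQ
  set X := xTrue L Δ lam2 f (Δ * f (K1 L)) with hXdef
  have hLpos : (0 : ℝ) < L := by exact_mod_cast (show 0 < L by omega)
  have hπ := Real.pi_pos
  have ht0 : 0 < t := by positivity
  -- regime facts (as in `trialGap_of_cellCheck`)
  have hlam : 0 < lam2 := lam2_pos L (by omega) hΔ1 hf.1
  have h2 : 2 * lam2 < eps1 L := two_lam2_lt_eps1 L (by omega) hΔ0 hf
  obtain ⟨ha0, haV, _, _⟩ := ManifoldA.manifold_band L hL hΔ0 hΔ1 hf
  have hνc := ManifoldA.nu_ceiling L hL hΔ0 hf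
  have hν4 : lam2 / (2 * Real.pi / L) ^ 2 < 4 / Real.pi ^ 2 := by
    rw [div_lt_iff₀ ht0]
    have hπ2 : Real.pi ^ 2 < 10 := by nlinarith [Real.pi_lt_d2, Real.pi_pos]
    have : (0.031 : ℝ) ≤ 4 / Real.pi ^ 2 := by rw [le_div_iff₀ (by positivity)]; nlinarith
    nlinarith
  have hV1 : (1 : ℝ) / (L : ℝ) ^ 2 = t * (4 * Real.pi ^ 2)⁻¹ := by
    show (1 : ℝ) / (L : ℝ) ^ 2 = (2 * Real.pi / L) ^ 2 * (4 * Real.pi ^ 2)⁻¹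
    field_simp; ring
  have hu' : 0 < 1 - Δ * f (K1 L) + Δ * f (K1 L) * ((2 * Real.pi / L) ^ 2 * (4 * Real.pi ^ 2)⁻¹) := by
    have : (2 * Real.pi / (L : ℝ)) ^ 2 * (4 * Real.pi ^ 2)⁻¹ = 1 / (L : ℝ) ^ 2 := hV1.symm
    rw [this]; nlinarith
  obtain ⟨_, _, _, _, d5, _, _⟩ := ManifoldA.manifold_dictionary L (by omega) hΔ0 hΔ1 hf
  have hu : 0 < cS L Δ lam2 f * Gzero L lam2 := by
    rw [← Gres_zero_zero_eq_Gzero, d5]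
    have : Δ * f (K1 L) / (L : ℝ) ^ 2 = Δ * f (K1 L) * ((2 * Real.pi / L) ^ 2 * (4 * Real.pi ^ 2)⁻¹) := by
      rw [← hV1]; ring
    rw [this]; exact hu'
  -- the interval layer of p2
  have hPM : PMem (c.box a1 a2) X := pmem_xTrue c hc a1 a2 L hL Δ lam2 f _ hν1 hν2 ha1 ha2
  have hsp := xTrue_specs_ground L Δ lam2 f (by omega) hΔ0 hΔ1 hf hlam h2 hν4 ha0 hu'
  set vB : ℝ := ((2 * Real.pi / L) ^ 2) ^ 3 * ∑ k : Tor L, F2 L f k ^ 2 * F2 L f (k + K1 L) with hvB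
  set vA : ℝ := ((2 * Real.pi / L) ^ 2) ^ 2 * ∑ k : Tor L, F2 L f k ^ 2 * cosx L k with hvA
  set vJ : ℝ := ((2 * Real.pi / L) ^ 2) ^ 2 * ∑ k : Tor L, bcJ L f k with hvJ
  have oB := bHat_mem L Δ lam2 f (by omega) hΔ0 hΔ1 hf hlam h2 hu
  have oP := pHat_mem L Δ lam2 f (by omega) hΔ0 hΔ1 hf hlam h2 hu
  have oA := aHat_mem L Δ lam2 f (by omega) hΔ0 hΔ1 hf hlam h2 hu
  have oQ := q1Hat_mem L Δ lam2 f (by omega) hΔ0 hΔ1 hf hlam h2 hu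
  have oJ := j1Hat_mem L Δ lam2 f (by omega) hΔ0 hΔ1 hf hlam h2 hu
  have hob : ∀ j (hj : j < (objSpecsC 2).length) (hj' : j < [vB, vP, vA, vQ, vJ].length),
      ((objSpecsC 2)[j].1).eval X ≤ [vB, vP, vA, vQ, vJ][j] ∧ [vB, vP, vA, vQ, vJ][j] ≤ ((objSpecsC 2)[j].2).eval X := by
    intro j hj hj'
    have hj5 : j < 5 := by simpa [objSpecsC] using hj
    interval_cases j
    · simpa [objSpecsC] using oB
    · simpa [objSpecsC] using oP
    · simpa [objSpecsC] using oA
    · simpa [objSpecsC] using oQ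
    · simpa [objSpecsC] using oJ
  -- unpack the row-C check
  have hlen0 : (c.box a1 a2).length = 16 := by simp [L2.NamedCell.box]
  have hv := specsVarsOkC_two
  simp only [specsVarsOkC, Bool.and_eq_true] at hv
  obtain ⟨hv1, hv2⟩ := hv
  have hS : SpecsHold X (c.box a1 a2).length (specs 2) := by
    rw [hlen0]; exact specsHold_of X (specs 2) 16 hv1 hsp
  unfold rowCCellCheck cellFinalBoxC cellBox at hchk
  split at hchk
  · exact absurd hchk (by simp)
  · rename_i F hF
    split at hF
    · exact absurd hF (by simp)
    · rename_i B hB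
      split at hF
      · exact absurd hF (by simp)
      · rename_i objs hobjs
        simp only [Option.some.injEq] at hF
        subst hF
        obtain ⟨hPB, hlenB⟩ := extendBox_sound pi.1 pi.2 X (specs 2) _ B hB hPM hS
        have hO : ObjsHold X B.length (objSpecsC 2) [vB, vP, vA, vQ, vJ] := by
          rw [hlenB, hlen0]
          exact objsHold_of X _ (objSpecsC 2) [vB, vP, vA, vQ, vJ] (by simp [objSpecsC]) hv2 hob
        have hbr := encloseObjs_sound pi.1 pi.2 hPB (objSpecsC 2) [vB, vP, vA, vQ, vJ] objs hobjs hO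
        have hmem := finalBox_mem hPB (by
          rw [hlenB, hlen0]
          simp only [specs, List.length_append, List.length_cons, List.length_nil, List.length_map]
          omega) hbr
        simp only [Bool.and_eq_true, decide_eq_true_eq] at hchk
        obtain ⟨⟨⟨⟨hFlen, hR⟩, hP⟩, _⟩, _⟩ := hchk
        obtain ⟨y0, y1, y2, y3, y4, y5, y6, y7, y8, y9⟩ := finalVec_vals X vB vP vA vQ vJ
        -- coordinates of `X`
        have hX0 : X 0 = t := xTrue_zero L Δ lam2 f _
        have hX1 : X 1 = Real.pi ^ 2 := by rw [hXdef, xTrue_lt16 L Δ lam2 f _ (by norm_num)]; rfl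
        have hX2 : X 2 = lam2 / t := by rw [hXdef, xTrue_lt16 L Δ lam2 f _ (by norm_num)]; rfl
        have hX3 : X 3 = Δ * f (K1 L) := by rw [hXdef, xTrue_lt16 L Δ lam2 f _ (by norm_num)]; rfl
        have hX4 : X 4 = t ^ 2 * S2n L lam2 := by
          rw [hXdef, xTrue_lt16 L Δ lam2 f _ (by norm_num)]
          show (2 * Real.pi / L) ^ (2 * 2) * S2n L lam2 = _
          ring
        have hX7 : X 7 = t ^ 2 * T10n L lam2 := by
          rw [hXdef, xTrue_lt16 L Δ lam2 f _ (by norm_num)]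
          show (2 * Real.pi / L) ^ (2 * 2) * T10n L lam2 = _
          ring
        have hX16 : X 16 = eps1 L / t := by rw [hXdef, xTrue_16]; rfl
        -- the brackets of `x₄`, `x₇` from the column box
        have hB4 := hPM 4 (by rw [hlen0]; norm_num)
        have hB7 := hPM 7 (by rw [hlen0]; norm_num)
        have e4 : (c.box a1 a2).ivl 4 = c.bS2 := by simp [L2.NamedCell.box, Box.ivl]
        have e7 : (c.box a1 a2).ivl 7 = c.bT10 := by simp [L2.NamedCell.box, Box.ivl]
        rw [e4, hX4] at hB4
        rw [e7, hX7] at hB7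
        -- the window values and the extended vector
        obtain ⟨h11, h20⟩ := window_k11_k20 L hL hΔ0 hΔ1 hf
        set y' := extVec (finalVec X [vB, vP, vA, vQ, vJ]) (t ^ 2 * S2n L lam2) (aKer L lam2 (ex L + ey L))
          (aKer L lam2 (ex L + ex L)) with hy'
        have hmem' : (rowCBox c (finalBox B objs)).mem y' := extVec_mem c hFlen hmem hB4 h11 h20
        have eR := rexprLeOn_sound hR _ hmem'
        have eP1 := rexprLeOn_sound hP _ hmem'
        -- coordinates of `y'`
        have g0 : y' 0 = t := by simp [hy', extVec, y0, hX0]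
        have g1 : y' 1 = Real.pi ^ 2 := by simp [hy', extVec, y1, hX1]
        have g2 : y' 2 = lam2 / t := by simp [hy', extVec, y2, hX2]
        have g3 : y' 3 = Δ * f (K1 L) := by simp [hy', extVec, y3, hX3]
        have g4 : y' 4 = eps1 L / t := by simp [hy', extVec, y4, hX16]
        have g6 : y' 6 = vP := by simp [hy', extVec, y6]
        have g8 : y' 8 = vQ := by simp [hy', extVec, y8]
        have g10 : y' 10 = t ^ 2 * S2n L lam2 := by simp [hy', extVec]
        have g11 : y' 11 = aKer L lam2 (ex L + ey L) := by simp [hy', extVec]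
        have g12 : y' 12 = aKer L lam2 (ex L + ex L) := by simp [hy', extVec]
        rw [eval_rowCE y' g1 xshi bC, g0, g2, g3, g4, g6, g8, g10, g11, g12] at eR
        simp only [yP, RExpr.eval] at eP1
        rw [g6] at eP1
        have e0 : (((0 : ℚ)) : ℝ) = 0 := by push_cast; ring
        have e1' : (((-1 : ℚ)) : ℝ) = -1 := by push_cast; ring
        rw [e0] at eR
        rw [e1'] at eP1
        exact ⟨by linarith, hB4.2, hB7.2, eR⟩

/-- `T⁺ = θ²·(3ν − (3/2)·Q̂₁/P̂)` for the ground profile (p1's one-loop identities, as in `trialGap_of_cellCheck`). [folklore] -/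
theorem Tplus_eq_tau (hL : 2 ≤ L) {Δ lam2 : ℝ} {f : Tor L → ℝ} (hf : IsGroundTwoMagnon L Δ lam2 f)
    (hP : 0 < ((2 * Real.pi / L) ^ 2) ^ 3 * ∑ k : Tor L, F2 L f k ^ 3) :
    Tplus L Δ f = (2 * Real.pi / L) ^ 2 * (3 * (lam2 / (2 * Real.pi / L) ^ 2)
      - 3 / 2 * (((2 * Real.pi / L) ^ 2) ^ 2 * ∑ k : Tor L, nK L f k * F2 L f k)
        * (((2 * Real.pi / L) ^ 2) ^ 3 * ∑ k : Tor L, F2 L f k ^ 3)⁻¹) := by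
  have hLpos : (0 : ℝ) < L := by exact_mod_cast (show 0 < L by omega)
  have hπ := Real.pi_pos
  set t : ℝ := (2 * Real.pi / L) ^ 2 with ht
  have ht0 : 0 < t := by positivity
  have heven : ∀ r : Tor L, f (-r) = f r := hf.2.1
  have hQP := sum_piR_C0fn L hf.1
  have hPf := piNormOneLoop_holds L f heven
  have hQf := piC0OneLoop_holds L Δ lam2 f hf.1 heven
  rw [nn_sum_swap] at hQf
  have hVθ : ((L : ℝ) ^ 2) = 4 * Real.pi ^ 2 / t := by rw [ht]; field_simp; ring
  set SP : ℝ := ∑ k : Tor L, F2 L f k ^ 3 with hSP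
  set SQ : ℝ := ∑ k : Tor L, nK L f k * F2 L f k with hSQ
  have ht3 : 0 < t ^ 3 := by positivity
  have hSP0 : 0 < SP := by
    by_contra hneg
    push Not at hneg
    have : t ^ 3 * SP ≤ 0 := mul_nonpos_of_nonneg_of_nonpos ht3.le hneg
    linarith
  have eP : PiNormSq L f = SP / (L : ℝ) ^ 2 := by rw [hPf]
  have eQ : ∑ cc : Cfg L, piR L f cc * C0fn L Δ lam2 f cc = -(3 / 2) * SQ / (L : ℝ) ^ 2 := by
    rw [hQf]; unfold nK at hSQ; rw [hSQ]
    simp only [List.sum_map_mul_right]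
    field_simp
  have hVpos : (0 : ℝ) < (L : ℝ) ^ 2 := by positivity
  have hPpos : 0 < PiNormSq L f := by rw [eP]; positivity
  have hT : Tplus L Δ f = 3 * lam2 + (∑ cc : Cfg L, piR L f cc * C0fn L Δ lam2 f cc) / PiNormSq L f := by
    rw [hQP]; field_simp; ring
  rw [hT, eQ, eP]
  field_simp
  ring

/-- ★★★ **A PASSING ROW-C CELL CHECK GIVES THE (KT-2b″) BOUND FOR EVERY `L ≥ 128` ON THE CELL.** -/
theorem offPoleTail_of_rowCCheck (c : L2.NamedCell) (a1 a2 xshi bC : ℚ) (pi : ℕ × ℕ) (Dxs : ℕ)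
    (hchk : rowCCellCheck c a1 a2 xshi bC pi = true) (hc : c.check = true)
    (hxs : xsCellCheck 128 c.n1 c.n2 c.νd c.Tn c.Td Dxs c.bS2.2 c.bT10.2 xshi = true)
    (hZ : ∀ (Δ' lam2' : ℝ) (f' : Tor L → ℝ), 0 ≤ Δ' → Δ' < 1 → IsGroundTwoMagnon L Δ' lam2' f' →
      (∑ b ∈ shellWin L, C0fn L Δ' lam2' f' (ex L, b) ^ 2)
        ≤ ZwN ((2 * Real.pi / L) ^ 2) (lam2' / (2 * Real.pi / L) ^ 2) (Δ' * f' (K1 L)))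
    (hL : 128 ≤ L)
    {Δ lam2 : ℝ} {f : Tor L → ℝ} (hΔ0 : 0 ≤ Δ) (hΔ1 : Δ < 1) (hf : IsGroundTwoMagnon L Δ lam2 f)
    (hν1 : (c.n1 : ℝ) / c.νd ≤ lam2 / (2 * Real.pi / L) ^ 2) (hν2 : lam2 / (2 * Real.pi / L) ^ 2 ≤ (c.n2 : ℝ) / c.νd)
    (ha1 : ((a1 : ℚ) : ℝ) ≤ Δ * f (K1 L)) (ha2 : Δ * f (K1 L) ≤ ((a2 : ℚ) : ℝ)) :
    (ip L (resid L Δ f) (resid L Δ f)).re - polePart L Δ f - lowNormPart L Δ f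
      ≤ (bC : ℝ) * etaEff L lam2 * (2 * eps1 L - Tplus L Δ f) * Uunit L Δ f := by
  have hLpos : (0 : ℝ) < L := by exact_mod_cast (show 0 < L by omega)
  have hπ := Real.pi_pos
  have hL2 : 2 ≤ L := by omega
  set t : ℝ := (2 * Real.pi / L) ^ 2 with ht
  have ht0 : 0 < t := by positivity
  obtain ⟨hvP0, hx4, hx7, eR⟩ := rowC_core L c a1 a2 xshi bC pi hchk hc hL hΔ0 hΔ1 hf hν1 hν2 ha1 ha2
  have hT := Tplus_eq_tau L hL2 hf hvP0
  rw [← ht] at hvP0 hx4 hx7 eR hT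
  set vP : ℝ := t ^ 3 * ∑ k : Tor L, F2 L f k ^ 3 with hvP
  set vQ : ℝ := t ^ 2 * ∑ k : Tor L, nK L f k * F2 L f k with hvQ
  -- the X-sum certificate
  have hlamθ : lam2 = lam2 / t * (2 * Real.pi / L) ^ 2 := by rw [ht]; field_simp
  have hXS : XSn L lam2 ≤ ((xshi : ℚ) : ℝ) := by
    have h := xs_cell_sound 128 c.n1 c.n2 c.νd c.Tn c.Td Dxs c.bS2.2 c.bT10.2 xshi hxs L hL (lam2 / t)
      (by rw [ht]; exact hν1) (by rw [ht]; exact hν2)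
      (by rw [← hlamθ, ← ht]; exact hx4) (by rw [← hlamθ, ← ht]; exact hx7)
    rw [← hlamθ] at h; exact h
  -- the two closed-form majorants at the true profile
  have hChi := cs2_le_ChiN L hL hΔ0 hΔ1 hf ((xshi : ℚ) : ℝ) hXS
  have hNhi := nC0p_le_NhiN L hL hΔ0 hΔ1 hf _ (hZ Δ lam2 f hΔ0 hΔ1 hf)
  rw [← ht] at hChi hNhi
  -- the RHS identity
  obtain ⟨_, _, _, _, _, _, d7⟩ := ManifoldA.manifold_dictionary L (by omega) hΔ0 hΔ1 hf
  have hVθ : ((L : ℝ) ^ 2) = 4 * Real.pi ^ 2 / t := by rw [ht]; field_simp; ring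
  have hRHS : (bC : ℝ) * etaEff L lam2 * (2 * eps1 L - Tplus L Δ f) * Uunit L Δ f
      = 48 * (Real.pi ^ 2) ^ 2 * bC * (Real.pi ^ 2 * (lam2 / t))
          * (2 * (eps1 L / t) - (3 * (lam2 / t) - 3 / 2 * vQ * vP⁻¹)) * (3 * (lam2 / t) - 3 / 2 * vQ * vP⁻¹) := by
    unfold Uunit
    rw [d7, ← ht, hT, hVθ]
    field_simp
    ring
  -- the LHS chain
  have hmirror : ∀ r : Tor L, f (-r.1, r.2) = f r := ground_mirror L hL2 hf
  have hpieces := offPoleTailFromPieces_holds L hL2 Δ lam2 f hf hmirror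
  have hP0 := polePartNonneg_holds L Δ f
  have hN0 := lowNormPartNonneg_holds L Δ f
  have hsq : (3 * Real.sqrt (cs2 L f) + 3 * Real.sqrt (nC0p L Δ f)) ^ 2
      ≤ 9 * (Real.sqrt (ChiN t (lam2 / t) (Δ * f (K1 L)) (eps1 L / t) (t ^ 2 * S2n L lam2) xshi)
        + Real.sqrt (NhiN t (lam2 / t) (Δ * f (K1 L)) (t ^ 2 * S2n L lam2)
            (aKer L lam2 (ex L + ey L)) (aKer L lam2 (ex L + ex L)) (ZwN t (lam2 / t) (Δ * f (K1 L))))) ^ 2 := by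
    have s1 := Real.sqrt_le_sqrt hChi
    have s2 := Real.sqrt_le_sqrt hNhi
    have e : (3 * Real.sqrt (cs2 L f) + 3 * Real.sqrt (nC0p L Δ f)) ^ 2
        = 9 * (Real.sqrt (cs2 L f) + Real.sqrt (nC0p L Δ f)) ^ 2 := by ring
    rw [e]
    apply mul_le_mul_of_nonneg_left _ (by norm_num)
    apply pow_le_pow_left₀ (by positivity)
    linarith
  rw [hRHS]
  linarith [hpieces, hP0, hN0, hsq, eR]

end RowC

end Summit.HubbardSuperconductivity.HubbardSuperconductivity.Theorems.AnisotropyChord.Transfer.Fibre3
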